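import Summits.BirchSwinnertonDyer.BirchSwinnertonDyer.Theorems.GenusKolyvaginAtTwoGenusPrimitiveSupplyAtTwoTwistingPrime
import HarnessLib

/-!
# Route `GenusKolyvaginAtTwo`, crux #2 `GenusPrimitiveSupplyAtTwo` (stmt-BirchSwinnertonDyer-22136):
# MAZUR–RUBIN TWISTING PRIMES AT `2` WITH A PRESCRIBED INVOLUTION — the `Δ > 0` companion of `…TwistingPrime`
# (Frobenius prescribed on `E[2]` AND on `μ_m` by any `g ∈ Γ_ℚ` acting on `E[2]` as an involution moving a point)

Width seat `bsd-line-gk2-p4` g15 (cell `bsd-f1-sign2`), sequel of `…TwistingPrime` / `…TwistingPrimeLocal` (this lineage, g7: the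
`Δ < 0` supply, Frobenius prescribed by a complex conjugation `c₀`). THEOREMS ONLY (no definition, no named fact, no `sorry`); helper
`--supports stmt-BirchSwinnertonDyer-22136`; no item is closed; BSD is not proved by any of this.

WHY. The cell's AN-26S `F1Sign2.TwoDoor.TwoTranspositionSupplyAtTwo` (the two-transposition door at `Δ > 0`, `ε = −1`) needs primes `q` of
good reduction with Frobenius a TRANSPOSITION on `E[2]` (`(Δ/q) = −1`), a prescribed residue class (`q₁ ≡ −q₀ (mod 8N)`), and a prescribed
non-vanishing `loc_q z ≠ 0` of ONE class `z ∈ H¹(ℚ, E[2])`. At `Δ > 0` complex conjugation fixes `E[2]`, so the `c₀` of `exists_twistingPrime`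
must be replaced by an arbitrary `g ∈ Γ_ℚ` acting on `E[2]` as an involution that moves a point:

* §37 `exists_torsionFixing_smul_h1Eval_ne_of_smul_ne` — the KEY LEMMA of `…TwistingPrimeLocal` with `c₀` replaced by any `g` moving some
  `2`-torsion point: for `x ≠ 0` some `h ∈ Γ_{ℚ(E[2], ζ)}` has `g • [x, h] ≠ [x, h]` (same proof: the values `[x, h]` exhaust `E[2]`).
* §38 **`exists_twistingPrime_of_involution`** — for `ρ̄_{W,2}` onto, `g ∈ Γ_ℚ` with `g²` trivial on `E[2]` and `g` moving a `2`-torsion point,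
  `0 ≠ x ∈ H¹(ℚ, E[2])`, `m ≥ 1` with a primitive `m`-th root of unity `ζ`, and a bound `b`: a prime `ℓ > b`, `ℓ ∤ m`, with an arithmetic
  Frobenius `F` at `ℓ` acting on `E[2]` as `g`, with `F • ζ = g • ζ = ζ ^ ℓ` (so `ℓ ≡ a (mod m)` whenever `g • ζ = ζ^a`), and `x_ℓ ≠ 0`.
  Proof as in g7 (Čebotarev `frobenius_dense` in the open set `g h₀ · (𝒩_x ∩ Stab ζ)`), with ONE new twist: `[x, γ²] = g[x,h₀] + [x,h₀] + [x, g²]`,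
  and `h₀` is the key lemma's element when `[x, g²] = 0`, the identity otherwise.

Honest framing: KNOWN (Mazur–Rubin 2010 Lemma 3.5 / Prop. 3.3 choice of twisting primes via Čebotarev; Gross 1991 §9); kernel-new;
beyond-print theorem: no. Crux 22136 stays OPEN at (U) 24947 ∧ (CONV₂) 19220/24948.

References: [MazurRubin2010] Lemma 3.5, Prop. 3.3; [GrossLMS1991] §9 Prop. 9.1, Prop. 9.6; [McCallumLMS1991] §3; [SerreAbelianLadic1968] I §2.2.
-/

set_option linter.dupNamespace false -- tree convention: `Summit.BirchSwinnertonDyer.BirchSwinnertonDyer.Theorems` (summit = sub-problem)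
set_option autoImplicit false

noncomputable section

open scoped Classical Pointwise

namespace Summit.BirchSwinnertonDyer.BirchSwinnertonDyer.Theorems.GenusKolyTwistingPrime

open WeierstrassCurve NumberField IsDedekindDomain Field
open Literature.NumberTheory.GaloisRepresentations Literature.NumberTheory.EllipticCurves
open Literature.NumberTheory

variable (W : WeierstrassCurve ℚ) [W.IsElliptic]

/-! ## §37 The key lemma for an arbitrary element moving a `2`-torsion point -/

/-- **KEY LEMMA (general involution).** For `x ≠ 0` in `H¹(ℚ, E[2])` (`ρ̄_{W,2}` onto), any `g ∈ Γ_ℚ` moving some point of `E[2]`, and a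
root of unity `ζ`: some `h ∈ Γ_{ℚ(E[2])}` fixing `ζ` has `g • [x, h] ≠ [x, h]`. (The values `[x, h]`, `h ∈ Γ_{ℚ(E[2], ζ)}`, form a
`Γ_ℚ`-stable subgroup of `E[2]`; it is non-zero — else every `[x, ρ]`, `ρ ∈ Γ_{ℚ(E[2])}`, is `Γ_ℚ`-fixed (commutators fix `ζ`), hence `0`, hence
`x = 0` by Gross's Prop. 9.1 at `2` — so it is all of `E[2]` by transitivity, and `g` moves a `2`-torsion point.) The `Δ < 0`, `g = c₀` case is
`exists_torsionFixing_smul_h1Eval_ne`. [cite: MazurRubin2010, Lemma 3.5 and Prop. 3.3 (choice of twisting primes)] [cite: GrossLMS1991, §9 Prop. 9.1] -/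
theorem exists_torsionFixing_smul_h1Eval_ne_of_smul_ne (hsurj : W.HasSurjectiveModNGaloisRep 2)
    {g : absoluteGaloisGroup ℚ} (hgv : ∃ v : geomTorsion W (2 : ℤ), g • v ≠ v)
    {x : galH1Torsion W (2 : ℤ)} (hx : x ≠ 0) {m : ℕ} [NeZero m] {ζ : AlgebraicClosure ℚ}
    (hζ : IsPrimitiveRoot ζ m) :
    ∃ h ∈ torsionFixing W (2 : ℤ), h • ζ = ζ ∧
      g • h1Eval W (2 : ℤ) x h ≠ h1Eval W (2 : ℤ) x h := by
  have hpow : ∀ σ : absoluteGaloisGroup ℚ, ∃ i : ℕ, σ • ζ = ζ ^ i := fun σ ↦ by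
    have h1 : (σ • ζ) ^ m = 1 := by rw [← smul_pow', hζ.pow_eq_one, smul_one]
    obtain ⟨i, -, hi⟩ := hζ.eq_pow_of_pow_eq_one h1
    exact ⟨i, hi.symm⟩
  -- conjugates of `ζ`-fixing elements fix `ζ`
  have hconj : ∀ σ h : absoluteGaloisGroup ℚ, h • ζ = ζ → (σ * h * σ⁻¹) • ζ = ζ := by
    intro σ h hh
    obtain ⟨i, hi⟩ := hpow σ⁻¹
    rw [mul_smul, mul_smul, hi, smul_pow', hh, ← hi, smul_inv_smul]
  -- Step 1: some `h ∈ Γ_{ℚ(E[2], ζ)}` has `[x, h] ≠ 0`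
  have step1 : ∃ h ∈ torsionFixing W (2 : ℤ), h • ζ = ζ ∧ h1Eval W (2 : ℤ) x h ≠ 0 := by
    by_contra hcon
    push Not at hcon
    apply hx
    apply h1_restriction_injective_two_rat W hsurj
    intro ρ hρ
    apply eq_zero_of_forall_smul_eq W hsurj
    intro γ
    have hc1 : γ * ρ * γ⁻¹ ∈ torsionFixing W (2 : ℤ) := (torsionFixing_normal W _).conj_mem ρ hρ γ
    have hcomm_fix : γ * ρ * γ⁻¹ * ρ⁻¹ ∈ torsionFixing W (2 : ℤ) := mul_mem hc1 (inv_mem hρ)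
    have hcomm_ζ : (γ * ρ * γ⁻¹ * ρ⁻¹) • ζ = ζ := commutator_smul_rootOfUnity hζ γ ρ
    have h0 := hcon _ hcomm_fix hcomm_ζ
    rw [h1Eval_mul W _ x hc1, h1Eval_conj W _ x γ hρ, h1Eval_inv W _ x hρ, add_neg_eq_zero] at h0
    exact h0
  -- Step 2: `g` cannot fix every value
  by_contra hcon
  push Not at hcon
  obtain ⟨h₁, hh₁, hζ₁, hv₁⟩ := step1
  obtain ⟨v, hv⟩ := hgv
  apply hv
  by_cases hv0 : v = 0
  · rw [hv0, smul_zero]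
  have hsurj' : W.HasSurjectiveModNGaloisRep ((2 : ℕ) : ℤ) := by simpa using hsurj
  have h2Q : ((2 : ℕ) : ℚ) ≠ 0 := by norm_num
  obtain ⟨σ, hσ⟩ := exists_smul_eq_of_hasSurjectiveModNGaloisRep W 2 h2Q hsurj' hv₁ hv0
  have hmem : σ * h₁ * σ⁻¹ ∈ torsionFixing W (2 : ℤ) := (torsionFixing_normal W _).conj_mem h₁ hh₁ σ
  have hfix := hcon _ hmem (hconj σ h₁ hζ₁)
  rwa [h1Eval_conj W _ x σ hh₁, hσ] at hfix

/-! ## §38 Twisting primes with Frobenius prescribed by an involution `g` -/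

/-- **MAZUR–RUBIN TWISTING PRIMES AT `2` WITH A PRESCRIBED INVOLUTION (unconditional).** Let `E = W/ℚ` be elliptic with
`ρ̄_{E,2} : Γ_ℚ → Aut E[2]` onto, `g ∈ Γ_ℚ` with `g²` acting trivially on `E[2]` and `g` moving some `2`-torsion point (e.g. a transposition of
`E[2] ∖ 0`; at `Δ < 0` a complex conjugation), `0 ≠ x ∈ H¹(ℚ, E[2])`, `ζ` a primitive `m`-th root of unity (`m ≥ 1`) and `b` a bound. Then there
is a prime `ℓ > b`, `ℓ ∤ m`, with an arithmetic Frobenius `F` at `ℓ` such that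
* `F` acts on `E[2]` as `g`,
* `F • ζ = g • ζ` and `F • ζ = ζ ^ ℓ` (so `ℓ ≡ a (mod m)` whenever `g • ζ = ζ ^ a`: `2` and the primes of `N` can be steered in `ℚ(√d)`),
* **`x_ℓ ≠ 0` in `H¹(ℚ_ℓ, E[2])`**: `x ∉ ker (H¹(ℚ, E[2]) → H¹(ℚ_ℓ, E[2]))`.
Proof (Mazur–Rubin 2010 §§3–4 / Gross 1991 §9, McCallum 1991 §3 at `p = 2` over `ℚ`, as in `exists_twistingPrime`): pick `h₀ ∈ Γ_{ℚ(E[2],ζ)}`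
with `g[x,h₀] + [x,h₀] + [x,g²] ≠ 0` (the key lemma §37 when `[x, g²] = 0`, else `h₀ = 1`); the open set `g h₀·(𝒩_x ∩ Stab ζ)` of `Γ_ℚ`
contains a Frobenius `γ` at a place `v ∤ m`, `v > b` (Čebotarev, `frobenius_dense` + `Automorphic.chebotarev_artinRep_holds`); `γ` acts on `ζ`
as `g` and as `ζ ↦ ζ^{Nv}`; `γ² = (γ t γ⁻¹)·g²·t`-shaped lies in `Γ_{ℚ(E[2])} ∩ G_𝔓` with `[x, γ²] = g[x,h₀] + [x,h₀] + [x,g²] ≠ 0`, so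
`x_v ≠ 0` by the easy half of the local criterion; finally `ℚ_v ≅ ℚ_ℓ`.
[cite: MazurRubin2010, Prop. 3.3 and Lemma 3.5 (twisting primes via Čebotarev)] [cite: GrossLMS1991, §9 Prop. 9.6] [cite: McCallumLMS1991, §3 Cor. 3.2] -/
theorem exists_twistingPrime_of_involution (hsurj : W.HasSurjectiveModNGaloisRep 2)
    {g : absoluteGaloisGroup ℚ} (hg2 : g * g ∈ torsionFixing W (2 : ℤ))
    (hgv : ∃ v : geomTorsion W (2 : ℤ), g • v ≠ v)
    {x : galH1Torsion W (2 : ℤ)} (hx : x ≠ 0) {m : ℕ} (hm : m ≠ 0)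
    {ζ : AlgebraicClosure ℚ} (hprim : IsPrimitiveRoot ζ m) (b : ℕ) :
    ∃ ℓ : ℕ, ∃ _ : Fact ℓ.Prime, b < ℓ ∧ ¬ ℓ ∣ m ∧
      (∃ (v : HeightOneSpectrum (𝓞 ℚ)) (𝔓 : Ideal (absIntegers (𝓞 ℚ) ℚ))
          (F : absoluteGaloisGroup ℚ), (ℓ : 𝓞 ℚ) ∈ v.asIdeal ∧ 𝔓 ∈ v.primesAbove ∧
          IsArithFrobAt (𝓞 ℚ) F 𝔓 ∧ (∀ P : geomTorsion W (2 : ℤ), F • P = g • P) ∧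
          F • ζ = g • ζ ∧ F • ζ = ζ ^ ℓ) ∧
      x ∉ W.torsionLocalKer ℚ_[ℓ] (2 : ℤ) := by
  classical
  haveI : NeZero m := ⟨hm⟩
  have hn0 : (2 : ℤ) ≠ 0 := two_ne_zero
  -- ### the element `h₀ ∈ Γ_{ℚ(E[2], ζ)}` with `g[x,h₀] + [x,h₀] + [x,g²] ≠ 0`
  obtain ⟨h₀, hh₀T, hh₀ζ, hh₀v⟩ : ∃ h₀ ∈ torsionFixing W (2 : ℤ), h₀ • ζ = ζ ∧
      g • h1Eval W (2 : ℤ) x h₀ + h1Eval W (2 : ℤ) x h₀ + h1Eval W (2 : ℤ) x (g * g) ≠ 0 := by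
    by_cases hgg : h1Eval W (2 : ℤ) x (g * g) = 0
    · obtain ⟨h₀, hh₀T, hh₀ζ, hne⟩ := exists_torsionFixing_smul_h1Eval_ne_of_smul_ne W hsurj hgv hx hprim
      refine ⟨h₀, hh₀T, hh₀ζ, ?_⟩
      rw [hgg, add_zero]
      intro h0
      apply hne
      have h2v : h1Eval W (2 : ℤ) x h₀ + h1Eval W (2 : ℤ) x h₀ = 0 := by
        rw [← two_nsmul]; exact AddSubgroup.torsionBy.nsmul _
      rw [eq_neg_of_add_eq_zero_left h0, neg_eq_of_add_eq_zero_left h2v]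
    · exact ⟨1, (torsionFixing W (2 : ℤ)).one_mem, one_smul _ _, by rwa [h1Eval_one, smul_zero, zero_add, zero_add]⟩
  -- ### the finite exceptional set of places of `ℚ`
  set B : Finset ℕ := m.primeFactors ∪ Finset.range (b + 1) with hB
  set S : Set (HeightOneSpectrum (𝓞 ℚ)) := {v | ∃ q ∈ B, q.Prime ∧ (q : 𝓞 ℚ) ∈ v.asIdeal}
    with hS
  have hSfin : S.Finite := by
    have : S ⊆ ⋃ q ∈ (B.filter Nat.Prime), {v | (q : 𝓞 ℚ) ∈ v.asIdeal} := by
      intro v ⟨q, hqB, hq, hqv⟩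
      simp only [Set.mem_iUnion, Finset.mem_filter]
      exact ⟨q, ⟨hqB, hq⟩, hqv⟩
    refine Set.Finite.subset (Set.Finite.biUnion (Finset.finite_toSet _) fun q hq ↦ ?_) this
    rw [Finset.coe_filter, Set.mem_setOf_eq] at hq
    have hsub : {v : HeightOneSpectrum (𝓞 ℚ) | (q : 𝓞 ℚ) ∈ v.asIdeal}.Subsingleton :=
      fun v hv v' hv' ↦ HeightOneSpectrum.eq_of_natCast_mem_rat hq.2 hv hv'
    exact hsub.finite
  -- ### Čebotarev: a Frobenius in the open set `g h₀ · (𝒩 ∩ Stab ζ)`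
  set 𝒩 := evalKer W (2 : ℤ) (fun _ : Unit ↦ x) with h𝒩
  have h𝒩open : IsOpen (𝒩 : Set (absoluteGaloisGroup ℚ)) :=
    isOpen_evalKer W _ _ (isOpen_torsionFixing W hn0)
  set A : Subgroup (absoluteGaloisGroup ℚ) := MulAction.stabilizer (absoluteGaloisGroup ℚ) ζ with hA
  have hAopen : IsOpen (A : Set (absoluteGaloisGroup ℚ)) := by
    haveI : FiniteDimensional ℚ (IntermediateField.adjoin ℚ {ζ}) :=
      IntermediateField.adjoin.finiteDimensional
        ((AlgebraicClosure.isAlgebraic ℚ).isAlgebraic ζ).isIntegral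
    refine Subgroup.isOpen_mono (H₁ := (IntermediateField.adjoin ℚ {ζ}).fixingSubgroup) ?_
      (IntermediateField.fixingSubgroup_isOpen _)
    intro σ hσ
    rw [IntermediateField.mem_fixingSubgroup_iff] at hσ
    exact hσ ζ (IntermediateField.mem_adjoin_simple_self ℚ ζ)
  set U : Set (absoluteGaloisGroup ℚ) := (𝒩 : Set _) ∩ (A : Set _) with hU
  have hUopen : IsOpen U := h𝒩open.inter hAopen
  set O : Set (absoluteGaloisGroup ℚ) := (fun γ ↦ g * h₀ * γ) '' U with hO
  have hOopen : IsOpen O := (Homeomorph.mulLeft (g * h₀)).isOpenMap _ hUopen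
  have hOne : O.Nonempty := ⟨g * h₀ * 1, 1, ⟨𝒩.one_mem, A.one_mem⟩, rfl⟩
  obtain ⟨γ, hγO, v, hvS, 𝔓₀, h𝔓₀, hγ⟩ :=
    (absoluteGaloisGroup.frobenius_dense Automorphic.chebotarev_artinRep_holds ℚ S hSfin
      ).inter_open_nonempty O hOopen hOne
  obtain ⟨u, ⟨hu𝒩, huA⟩, rfl⟩ := hγO
  have huT : u ∈ torsionFixing W (2 : ℤ) := hu𝒩.1
  have hux : h1Eval W (2 : ℤ) x u = 0 := hu𝒩.2 ()
  have huζ : u • ζ = ζ := huA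
  set t := h₀ * u with ht
  have htT : t ∈ torsionFixing W (2 : ℤ) := mul_mem hh₀T huT
  have hγt : g * h₀ * u = g * t := by rw [ht, mul_assoc]
  -- ### the rational prime `ℓ` under `v` and `ℚ_v ≅ ℚ_ℓ`
  set ℓ : ℕ := (Rat.HeightOneSpectrum.primesEquiv (R := 𝓞 ℚ) v : ℕ) with hℓdef
  have hℓ : ℓ.Prime := (Rat.HeightOneSpectrum.primesEquiv (R := 𝓞 ℚ) v).2
  haveI hℓF : Fact ℓ.Prime := ⟨hℓ⟩
  have hℓv : (ℓ : 𝓞 ℚ) ∈ v.asIdeal := by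
    have h := (Rat.HeightOneSpectrum.natGenerator_dvd_iff (R := 𝓞 ℚ) v (n := ℓ)).mp dvd_rfl
    rw [Ideal.mem_map_iff_of_surjective _ (Rat.IsIntegralClosure.intEquiv (𝓞 ℚ)).surjective] at h
    obtain ⟨y, hy, hyℓ⟩ := h
    have : y = (ℓ : 𝓞 ℚ) := (Rat.IsIntegralClosure.intEquiv (𝓞 ℚ)).injective (by rw [hyℓ, map_natCast])
    rwa [this] at hy
  haveI : CharZero (v.adicCompletion ℚ) :=
    charZero_of_injective_algebraMap (algebraMap ℚ (v.adicCompletion ℚ)).injective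
  set θ : v.adicCompletion ℚ ≃+* ℚ_[ℓ] :=
    RingEquivClass.toRingEquiv (Rat.HeightOneSpectrum.adicCompletion.padicEquiv (R := 𝓞 ℚ) v)
    with hθ
  have hℓB : ℓ ∉ B := fun h ↦ hvS ⟨ℓ, h, hℓ, hℓv⟩
  simp only [hB, Finset.mem_union, Nat.mem_primeFactors, Finset.mem_range, not_or] at hℓB
  obtain ⟨hℓm', hℓb⟩ := hℓB
  have hℓm : ¬ ℓ ∣ m := fun h ↦ hℓm' ⟨hℓ, h, hm⟩
  have hbℓ : b < ℓ := by omega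
  -- ### the Frobenius acts on `ζ` as `g` does, and raises it to the `ℓ`-th power
  have hmv : (m : 𝓞 ℚ) ∉ v.asIdeal := natCast_not_mem_of_not_dvd hℓ hℓv hℓm
  have h1 : (g * h₀ * u) • ζ = g • ζ := by rw [mul_smul, mul_smul, huζ, hh₀ζ]
  have h2 : (g * h₀ * u) • ζ = ζ ^ v.residueCard :=
    smul_eq_pow_residueCard_of_isArithFrobAt_of_pow_eq_one hmv h𝔓₀ hγ hprim.pow_eq_one
  rw [residueCard_eq_of_natCast_mem_rat hℓ hℓv] at h2
  -- ### the Frobenius acts on `E[2]` as `g`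
  have hFE : ∀ P : geomTorsion W (2 : ℤ), (g * h₀ * u) • P = g • P := fun P ↦ by
    rw [hγt, mul_smul, smul_eq_of_mem_torsionFixing W _ htT]
  -- ### `[x, γ²] = g [x, h₀] + [x, h₀] + [x, g²] ≠ 0`
  have hγγ : (g * h₀ * u) * (g * h₀ * u) = (g * t * g⁻¹) * ((g * g) * t) := by
    rw [hγt]; group
  have hconjT : g * t * g⁻¹ ∈ torsionFixing W (2 : ℤ) := (torsionFixing_normal W _).conj_mem t htT g
  have hγγT : (g * h₀ * u) * (g * h₀ * u) ∈ torsionFixing W (2 : ℤ) := by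
    rw [hγγ]; exact mul_mem hconjT (mul_mem hg2 htT)
  have hval : h1Eval W (2 : ℤ) x ((g * h₀ * u) * (g * h₀ * u)) ≠ 0 := by
    rw [hγγ, h1Eval_mul W _ x hconjT, h1Eval_conj W _ x g htT, h1Eval_mul W _ x hg2, ht, h1Eval_mul W _ x hh₀T, hux,
      add_zero]
    intro h0
    apply hh₀v
    rw [← h0]
    abel
  -- ### the local criterion at `v`, then transport to `ℚ_ℓ`
  have hloc := not_mem_torsionLocalKer_of_h1Eval_sq_ne_zero W (n := 2) two_ne_zero h𝔓₀ hγ hγγT hval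
  refine ⟨ℓ, hℓF, hbℓ, hℓm, ⟨v, 𝔓₀, g * h₀ * u, hℓv, h𝔓₀, hγ, hFE, h1, h2⟩, fun hx' ↦ hloc ?_⟩
  exact (mem_torsionLocalKer_padic_iff W θ (2 : ℤ) x).mp hx'

end Summit.BirchSwinnertonDyer.BirchSwinnertonDyer.Theorems.GenusKolyTwistingPrime

end
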